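import Summits.BirchSwinnertonDyer.Rank1Residual.GaloisImage.KuriharaRecordCorollaryThreeDeep
import Summits.BirchSwinnertonDyer.Rank1Residual.GaloisImage.KuriharaRecordBSDpThreeLevelTwoEndNoEP
import Summits.BirchSwinnertonDyer.BirchSwinnertonDyer.Theorems.KimAtThreeDeepLowerKatoStratumOfFacts
import Summits.BirchSwinnertonDyer.BirchSwinnertonDyer.Theorems.KimAtThreeKolyvaginMinimalCertificate
import HarnessLib

/-!
# Crux `DeepLowerAtThree` (item 19075) on the additive `3 ∤ c₃` tower stratum for EVERY `3`-torsion
# exponent `t = v₃ #E(ℚ₃)[3]`, GRANTED cell n1011's DEEP ports — route W2 `KimAtThreeKolyvagin`, cell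
# `bsd-addord`, seat w2-c2 (D-0074 row B5)

HONEST FRAMING. Theorems only (no definition, no named fact minted, no `sorry`); nothing asserted,
nothing booked; crux 19075 stays OPEN. Seat kim3's gen-8 rung
(`KimAtThreeKolyvaginDeepLowerKatoStratumPartial.deepLower_optimal_of_ports`, and its named-facts form
`KimAtThreeDeepLowerKatoStratumOfFacts.deepLower_optimal_of_ports_of_poitouTate`) gives the `∂`-currency
conclusion of crux 19075 on the Kato stratum at `t = 0` ONLY (`E(ℚ₃)[3] = 0`; the repaired port
`KatoKuriharaPortThreeAtWith₂` exists at `t = 0`). This file covers EVERY `t` — the rows with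
`E(ℚ₃)[3] ≠ 0` included — by composing cell n1011's DEEP record corollary
`Assembly.exists_LOmega_padicValRat_le_of_towerSurj_deep` (Cor C-t of memo kim3/KIM3-PROOF.md §16 in
BSD currency: a MINIMAL certificate of modulus `3^j` at a cyclic `n ∈ 𝒩_{k+t+1}(E,3)` with
`t + j ≤ k + 1` forces `ord₃(L(E,1)/Ω(W)) ≤ ord₃ #Ш(E/ℚ)(3) + (j − 1)`) with kim3's END-shape bridge
`KimAtThreeKolyvaginMinimalCertificate.deepLower_datum_of_endShapeBound` at the depth threshold
`K = 2t + 1` (a certificate at depth `L ≥ 2t + j` is read at shallow depth `k = L − t − 1`).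
PRICE (all hypotheses BY NAME, nothing asserted): the two S24-DEEP ports `hS24d`/`hS24d₂`
(`S24Deep.kolyvaginSystems_{freeRankOne,idealOfBasis_eq_fittingIdeal}_zmod_three_pow_deep`: [S24]
Thm. 4.4 (1)(2) on the DEEP Frobenius sub-classes — FLAG `S24-DEEP-PORT@3`, NOT the printed theorem,
unlike the `t = 0` rung), GZK `hGZK`, modularity `hmod`, the Cremona/Agashe–Ribet–Stein Manin fact
`h26` (`|c| = 1` for optimal curves of conductor `≤ 130000`), Poitou–Tate `hPT`
(`poitouTate_selmerStructure_duality ℚ`, supplying n1011's nine Poitou–Tate binders as in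
`KimAtThreeDeepLowerKatoStratumOfFacts`), Tate's local Euler–Poincaré characteristic DISCHARGED by
name (`Assembly.localEulerPoincareCharacteristic_rat`, proved in the tree), and ONE unrepaired
dictionary port `KatoKuriharaPortThreeAt W t v₃` (FLAG `K22-Thm3.13-PORT@3`: Kim's refined explicit
reciprocity law at an additive `3`, not in print at `3`). ROW: `3`-adic tower onto, ADDITIVE `3` with
`3 ∤ c₃`, `#E(ℚ₃)[3] = 3^t`, an OPTIMAL datum `D` at the conductor `N = N_E ≤ 130000`, `ord(δ̃) = 0`.
NOT COVERED: `3 ∣ c₃`; non-additive `3`; conductor `> 130000` (use the `_of_manin` form with `3 ∤ c_D`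
displayed — not provided here since n1011's deep record fixes the Cremona range).

* `deepLower_optimal_of_deepPorts` — the rung, all `t`.

References: [Kim2025RefinedTNC] Thm 1.1; [Kim2022StructureSelmer] Thm. 1.9 (6), Thm. 3.13;
[Sakamoto2024] Thm. 4.4; [MazurRubin2004] Thm. 5.2.12, Cor. 5.2.13; [MilneADT2006] I Thm. 4.10;
[AgasheRibetStein2006] Thm. 2.6; memo `run/shared/lean/pub/bsd-addord/kim3/KIM3-PROOF.md` §14, §16.
-/

-- the Theorems namespace of a single-conjunct summit repeats the summit name by design (D-0017)
set_option linter.dupNamespace false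

noncomputable section

open scoped Classical NumberField
open Function Field NumberField IsDedekindDomain WeierstrassCurve
  Literature.NumberTheory.EllipticCurves Literature.NumberTheory.EllipticCurves.ModularForms
  Literature.NumberTheory.EllipticCurves.Rank1Residual
  Literature.NumberTheory.EllipticCurves.AgasheRibetStein2006
  Literature.NumberTheory.GaloisRepresentations Literature.NumberTheory.GaloisCohomology
  Summit.BirchSwinnertonDyer.Rank1Residual.GaloisImage
  Summit.BirchSwinnertonDyer.Rank1Residual.GaloisImage.Assembly
  Summit.BirchSwinnertonDyer.Rank1Residual.X4
  Summit.BirchSwinnertonDyer.BirchSwinnertonDyer.Theorems.KimAtThreeKolyvaginUnitLevelOneRungs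
  Summit.BirchSwinnertonDyer.BirchSwinnertonDyer.Theorems.KimAtThreeKolyvaginMinimalCertificate
  Summit.BirchSwinnertonDyer.BirchSwinnertonDyer.Theorems.KimAtThreeDeepLowerKatoStratumOfFacts

namespace Summit.BirchSwinnertonDyer.BirchSwinnertonDyer.Theorems.KimAtThreeDeepLowerDeepPortStratum

/-- **Crux `DeepLowerAtThree` for EVERY `t`, GRANTED n1011's deep ports.** For `W/ℚ` globally minimal,
ADDITIVE at `3` with `3 ∤ c₃`, the `3`-adic tower onto, `#E(ℚ₃)[3] = 3^t`, an OPTIMAL parametrisation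
datum `D` at the conductor `N = N_E ≤ 130000`, and `ord(δ̃) = 0` for the Kurihara numbers of `D.f`;
GRANTED `hS24d`/`hS24d₂` (S24-DEEP ports), `hGZK`, `hmod`, `h26`, `hPT` and ONE dictionary port
`KatoKuriharaPortThreeAt W t v₃`: `∂^{(∞)}_deep(δ̃) = d ∈ ℕ` and `∂⁽⁰⁾(δ̃) ≤ ord₃ #Ш(E/ℚ)(3) + d` — the
conclusion of item 19075 for `(W, D.f)`. Proof: `ord(δ̃) = 0 ⇒ L(E,1) ≠ 0 ⇒` analytic rank `0`; `3 ∤ c_D`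
and the `3`-adic period transfer from optimality in the Cremona range; Poitou–Tate families from
`hPT`; then `deepLower_datum_of_endShapeBound` at `K = 2t + 1`, each END-shape certificate of modulus
`3^{j′}` at a cyclic `n ∈ 𝒩_L(E,3)`, `2t + j′ ≤ L`, being fed to n1011's
`exists_LOmega_padicValRat_le_of_towerSurj_deep` at `k = L − t − 1` (`n ∈ 𝒩_{k+t+1}`,
`t + j′ ≤ k + 1`; Kolyvagin primes do not divide the conductor). Nothing asserted; the crux stays open.
[cite: Kim2025RefinedTNC, Thm 1.1] [cite: Kim2022StructureSelmer, Thm. 1.9 (6), Thm. 3.13]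
[cite: Sakamoto2024, Thm. 4.4 (p. 926)] [cite: MilneADT2006, Ch. I, Thm. 4.10]
[cite: AgasheRibetStein2006, Thm. 2.6 (p. 619)] [cite: MazurRubin2004, Thm. 5.2.12, Cor. 5.2.13] -/
theorem deepLower_optimal_of_deepPorts
    (hS24d : S24Deep.kolyvaginSystems_freeRankOne_zmod_three_pow_deep)
    (hS24d₂ : S24Deep.kolyvaginSystems_idealOfBasis_eq_fittingIdeal_zmod_three_pow_deep)
    (hGZK : rank_eq_analyticRank_of_analyticRank_le_one) (hmod : hasEntireLFunction_rat)
    (h26 : cremona_abs_maninConstant_eq_one_of_level_le)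
    (hPT : poitouTate_selmerStructure_duality ℚ)
    (W : WeierstrassCurve ℚ) [W.IsElliptic] [W.IsGloballyMinimal] (t : ℕ)
    (hadd : haveI : Fact (Nat.Prime 3) := ⟨Nat.prime_three⟩; Addv W 3)
    (hc3 : ¬ 3 ∣ (W.baseChange ℚ_[3]).localTamagawaNumber ℤ_[3])
    (htower : ∀ m : ℕ, W.HasSurjectiveModNGaloisRep (3 ^ m : ℕ))
    (ht : Nat.card {Q : (W.baseChange ℚ_[3]).toAffine.Point // (3 : ℕ) • Q = 0} = 3 ^ t)
    {N : ℕ} [NeZero N] (hN : N ≤ 130000) (hNc : N = W.conductorNorm ℤ)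
    (D : ModularParametrizationData W N)
    (hopt : ∀ z ∈ D.L.lattice, ∃ w ∈ periodLattice D.f, z = D.c * w)
    (v₃ : HeightOneSpectrum (𝓞 ℚ)) (hv₃ : ((3 : ℕ) : 𝓞 ℚ) ∈ v₃.asIdeal)
    (hPort : KatoKuriharaPortThreeAt W t v₃)
    (hord : kuriharaVanishingOrder W 3 D.f = 0) :
    ∃ d : ℕ, kuriharaPartialDeepInfty W 3 D.f = d ∧
      kuriharaPartial W 3 D.f 0 ≤
        ((padicValNat 3 (Nat.card (AddCommGroup.primaryComponent W.sha 3)) + d : ℕ) : ℕ∞) := by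
  haveI : Fact (Nat.Prime 3) := ⟨Nat.prime_three⟩
  -- analytic rank `0` from `ord(δ̃) = 0`
  have h0 : ratPlusSymbol D.f 0 ≠ 0 :=
    ratPlusSymbol_zero_ne_zero_of_kuriharaVanishingOrder_eq_zero W 3 D.f hord
  have hL : W.entireLFunction 1 ≠ 0 :=
    D.isNewformOf.entireLFunction_one_ne_zero_of_ratPlusSymbol_zero_ne_zero h0
  have hr : W.analyticRank = 0 := analyticRank_eq_zero_of_entireLFunction_one_ne_zero hL
  -- `3 ∤ c_D` and the period transfer, from optimality in the Cremona range
  have hcD : ¬ (3 : ℤ) ∣ D.maninConstant :=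
    not_dvd_maninConstant_of_level_le h26 W D hopt hN Nat.prime_three
  have hper : ∃ u : ℚ, ‖(u : ℚ_[3])‖ = 1 ∧ W.realPeriodRat = u * plusPeriod D.f :=
    periodTransfer_of_optimal 3 D hopt hcD
  -- the Poitou–Tate families from the named fact
  obtain ⟨inv, hperf, hsum, -, hcompl⟩ := hPT 3
  obtain ⟨inv', hperf', hsum', hcompl', hinj'⟩ := exists_localInvariants_three_pow_of_poitouTate hPT
  -- the END-shape bound at depth threshold `2t + 1`, from n1011's deep record corollary
  refine deepLower_datum_of_endShapeBound W htower D hper hord (2 * t + 1) ?_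
  intro j' L n hj' hKL hcyc hLn ψ hψ hne hv
  haveI : NeZero n := ⟨hLn.ne_zero⟩
  have hk : L - t - 1 + t + 1 = L := by omega
  have hn' : Kato.IsKolyvaginProduct W 3 (L - t - 1 + t + 1) n := by rw [hk]; exact hLn
  exact exists_LOmega_padicValRat_le_of_towerSurj_deep hS24d hS24d₂ hGZK hmod h26 W t (L - t - 1)
    hadd hc3 htower ht hr hN D hopt inv hperf hsum hcompl inv' hperf' hsum' hcompl' hinj'
    localEulerPoincareCharacteristic_rat v₃ hv₃ hPort n hn' (fun ℓ _ hℓ => hcyc.2 ℓ hℓ)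
    (fun ℓ hℓ hℓN => (hLn.2 ℓ hℓ).not_dvd_conductorNorm (hNc ▸ hℓN)) (j := j') (by omega) ψ hψ
    hne hv


/-! ## ERRATUM (seat w2-c2, 2026-08-26T04:15Z) — VACUOUS PORT

The dictionary port taken by name in this file, `KatoKuriharaPortThreeAt W t v₃` (the universal-closure
PORT), is REFUTED at `t = 0` on every row of its population carrying a unit Kurihara number by cell
n1011's T-PORT-NEG (`Summits/BirchSwinnertonDyer/Rank1Residual/GaloisImage/KatoKuriharaPortThreeRefutation.lean`:
`not_katoKuriharaPortThreeAt_zero_of_kuriharaNumber_ne_zero`, `not_katoKuriharaPortThreeAt_zero_of_unit`;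
the generator-sign anomaly does not depend on `t`). The theorems above are therefore correct but
VACUOUS as rungs of item 19075 and must not be cited as evidence. The repaired statement, keyed to the
shared-generator closure PORT′ `KatoKuriharaPortThreeAtWith W t v₃ η` (the repair designated by
T-PORT-NEG) over a shared-`η` deep family, is `KimAtThreeDeepLowerDeepPortWith.lean`
(`deepLower_{datum,optimal,newform}_of_deepPortsWith`). -/

end Summit.BirchSwinnertonDyer.BirchSwinnertonDyer.Theorems.KimAtThreeDeepLowerDeepPortStratum

end
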